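import Literature.Probability.Percolation.CriticalProbOrientedBound
import HarnessLib

/-!
# Counting oriented walks on `ℤ^d`: endpoint counts, the multinomial identity, `P(S_k = S'_k)`

Topic `Literature/Probability/Percolation`.  Sorry-free, no named facts.  Toolkit for the explicit
random-walk estimates in Bock–Damron–Newman–Sidoravicius, *Percolation of finite clusters and
shielded paths*, J. Stat. Phys. 179 (2020), §4 (Lemma 4.1 and the proof of Corollary 1.5), which
concern two independent uniform oriented walks `S_k, S'_k` on `ℤ^d` (steps `+e_1, …, +e_d` with
probability `1/d` each):

* `endCount d k x = #{w : opos w k = x}` (so `P(S_k = x) = endCount d k x / d^k`), its first-step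
  recursion, and the multinomial identity `endCount · ∏ xᵢ! = k!` (`endCount_natCast_mul_prod_factorial`);
* the bounds of BDNS (4.8)–(4.9) (following Cox–Durrett 1983): `P(S_k = x) ≤ k!/d^k`
  (`endCount_le_factorial`), `max_x P(S_k = x)` is non-increasing in `k` (`endCount_succ_le`), and
  `P(S_{jd} = x) ≤ d^{-jd} (jd)!/(j!)^d` (`endCount_balanced_mul_le`, from `(j!)^d ≤ ∏ xᵢ!` when
  `Σ xᵢ = jd`, `pow_factorial_le_prod_factorial`);
* `diffProb d k z = P(S'_k - S_k = z)` as a normalized pair count, its first-step recursion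
  (`diffProb_succ`, the difference chain moves by `e_a - e_{a'}`), and
  `P(S'_k - S_k = z) ≤ max_x P(S_k = x)` (`diffProb_le_of_endCount_le`), whence
  `diffProb d k z ≤ k!/d^k` and `diffProb d (jd + i) z ≤ (jd)!/((j!)^d d^{jd})`.

## References

* B. Bock, M. Damron, C. M. Newman, V. Sidoravicius, J. Stat. Phys. 179 (2020) 789–807,
  arXiv:1811.01678, §4, (4.8)–(4.9). [BockEtAl2020]
* J. T. Cox, R. Durrett, Math. Proc. Cambridge Philos. Soc. 93 (1983) 151–162, §3. [CoxDurrett1983]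
-/

noncomputable section

namespace Literature.Probability.Percolation

open Finset Literature.Probability.LatticeModels
open scoped Nat

variable {d : ℕ}

/-! ### Coordinates of positions -/

/-- The `i`-th coordinate of `opos w k` is the number of steps in direction `i` among the first `k`.
[folklore] -/
theorem opos_apply {n : ℕ} (w : Fin n → Fin d) (k : ℕ) (i : Fin d) :
    opos w k i = ((univ.filter fun j : Fin n => (j : ℕ) < k ∧ w j = i).card : ℤ) := by
  rw [opos, Finset.sum_apply, Finset.natCast_card_filter]
  refine Finset.sum_congr rfl fun j _ => ?_
  by_cases h1 : (j : ℕ) < k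
  · by_cases h2 : w j = i
    · simp [h1, h2]
    · have : i ≠ w j := fun h => h2 h.symm
      simp [h1, h2, this]
  · simp [h1]

/-- Coordinates of positions of oriented walks are nonnegative. [folklore] -/
theorem opos_nonneg {n : ℕ} (w : Fin n → Fin d) (k : ℕ) (i : Fin d) : 0 ≤ opos w k i := by
  rw [opos_apply]
  positivity

/-! ### Endpoint counts `#{w : S_k = x}` -/

/-- The number of oriented words of length `k` ending at `x` (`d^k · P(S_k = x)`).
[cite: BockEtAl2020, §4 (4.8)] -/
def endCount (d k : ℕ) (x : Site d) : ℕ :=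
  (univ.filter fun w : Fin k → Fin d => opos w k = x).card

/-- Unreachable sites: a negative coordinate or the wrong level. [folklore] -/
theorem endCount_eq_zero {k : ℕ} {x : Site d} (h : (∃ i, x i < 0) ∨ level x ≠ k) :
    endCount d k x = 0 := by
  rw [endCount, Finset.card_eq_zero, Finset.filter_eq_empty_iff]
  intro w _ hw
  rcases h with ⟨i, hi⟩ | hl
  · have := opos_nonneg w k i
    rw [hw] at this
    exact absurd hi (not_lt.2 this)
  · exact hl (hw ▸ level_opos w le_rfl)

/-- The empty word ends at the origin. [folklore] -/
theorem endCount_zero_zero : endCount d 0 0 = 1 := by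
  rw [endCount, Finset.filter_true_of_mem fun w _ => opos_zero w, Finset.card_univ,
    Fintype.card_fun]
  simp

/-- First-step recursion: `#{S_{k+1} = x} = Σ_a #{S_k = x - e_a}`. [cite: BockEtAl2020, §4] -/
theorem endCount_succ (k : ℕ) (x : Site d) :
    endCount d (k + 1) x = ∑ a : Fin d, endCount d k (x - Pi.single a 1) := by
  simp only [endCount, Finset.card_filter]
  rw [sum_word_succ]
  refine Finset.sum_congr rfl fun a _ => Finset.sum_congr rfl fun v _ => ?_
  rw [opos_cons_succ]
  have : (Pi.single a 1 + opos v k = x) ↔ (opos v k = x - Pi.single a 1) := by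
    constructor <;> intro h <;> linear_combination h
  simp only [this]

/-- `max_x #{S_{k+1} = x} ≤ d · max_x #{S_k = x}`, i.e. `max_x P(S_k = x)` is non-increasing in
`k`. [cite: BockEtAl2020, §4 (before (4.9))] -/
theorem endCount_succ_le {k C : ℕ} (hC : ∀ x, endCount d k x ≤ C) (x : Site d) :
    endCount d (k + 1) x ≤ d * C := by
  rw [endCount_succ]
  calc ∑ a : Fin d, endCount d k (x - Pi.single a 1) ≤ ∑ _a : Fin d, C :=
        Finset.sum_le_sum fun a _ => hC _
    _ = d * C := by simp

/-- Iterated: `#{S_{k+i} = x} ≤ d^i · max_y #{S_k = y}`. [cite: BockEtAl2020, §4 (before (4.9))] -/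
theorem endCount_add_le {k C : ℕ} (hC : ∀ x, endCount d k x ≤ C) (i : ℕ) (x : Site d) :
    endCount d (k + i) x ≤ d ^ i * C := by
  induction i generalizing x with
  | zero => simpa using hC x
  | succ i ih =>
    rw [← add_assoc, pow_succ, mul_comm (d ^ i) d, mul_assoc]
    exact endCount_succ_le ih x

/-! ### The multinomial identity -/

/-- Removing one unit from coordinate `a` of a nonnegative integer vector. [folklore] -/
theorem natCast_update_eq_sub (m : Fin d → ℕ) (a : Fin d) {m' : ℕ} (ha : m a = m' + 1) :
    (fun i => ((Function.update m a m' i : ℕ) : ℤ)) = (fun i => (m i : ℤ)) - Pi.single a 1 := by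
  funext i
  by_cases hi : i = a
  · subst hi
    simp [ha]
  · simp [Function.update_of_ne hi, Pi.single_eq_of_ne hi]

/-- **Multinomial identity**: for `m : Fin d → ℕ` with `Σ mᵢ = k`, the number of words of length
`k` using letter `i` exactly `mᵢ` times satisfies `#{…} · ∏ mᵢ! = k!`. [folklore] -/
theorem endCount_natCast_mul_prod_factorial (k : ℕ) (m : Fin d → ℕ) (hm : ∑ i, m i = k) :
    endCount d k (fun i => (m i : ℤ)) * ∏ i, (m i)! = k ! := by
  induction k generalizing m with
  | zero =>
    have hm0 : m = 0 := by
      funext i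
      exact (Finset.sum_eq_zero_iff.1 hm) i (Finset.mem_univ i)
    subst hm0
    have : (fun i : Fin d => ((0 : Fin d → ℕ) i : ℤ)) = 0 := by funext i; simp
    rw [this, endCount_zero_zero]
    simp
  | succ k ih =>
    rw [endCount_succ, Finset.sum_mul]
    have hterm : ∀ a : Fin d,
        endCount d k ((fun i => (m i : ℤ)) - Pi.single a 1) * ∏ i, (m i)! = m a * k ! := by
      intro a
      rcases Nat.eq_zero_or_eq_succ_pred (m a) with ha | ha
      · rw [ha, zero_mul, endCount_eq_zero (Or.inl ⟨a, ?_⟩), zero_mul]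
        simp [ha]
      · set m' := (m a).pred
        have hupd : ∑ i, Function.update m a m' i = k := by
          have h1 : ∑ i, Function.update m a m' i + 1 = ∑ i, m i := by
            rw [← Finset.add_sum_erase univ m (Finset.mem_univ a),
              ← Finset.add_sum_erase univ (Function.update m a m') (Finset.mem_univ a),
              Function.update_self,
              Finset.sum_congr rfl (fun i hi => Function.update_of_ne (Finset.mem_erase.1 hi).1 m' m),
              ha, Nat.succ_eq_add_one]
            ring
          omega
        have hprod : ∏ i, (m i)! = m a * ∏ i, (Function.update m a m' i)! := by
          rw [← Finset.mul_prod_erase univ (fun i => (m i)!) (Finset.mem_univ a),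
            ← Finset.mul_prod_erase univ (fun i => (Function.update m a m' i)!) (Finset.mem_univ a)]
          have h2 : ∀ i ∈ univ.erase a, (Function.update m a m' i)! = (m i)! := by
            intro i hi
            rw [Finset.mem_erase] at hi
            rw [Function.update_of_ne hi.1]
          rw [Finset.prod_congr rfl h2, Function.update_self, ← mul_assoc]
          congr 1
          rw [ha, Nat.succ_eq_add_one, Nat.factorial_succ]
        rw [← natCast_update_eq_sub m a ha, hprod, mul_left_comm, ih _ hupd]
    rw [Finset.sum_congr rfl fun a _ => hterm a, ← Finset.sum_mul, hm, Nat.factorial_succ]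

/-- `#{S_k = x} ≤ k!` (BDNS (4.8): `max_x P(S_k = x) ≤ k!/d^k`). [cite: BockEtAl2020, §4 (4.8)] -/
theorem endCount_le_factorial (k : ℕ) (x : Site d) : endCount d k x ≤ k ! := by
  by_cases hneg : ∃ i, x i < 0
  · rw [endCount_eq_zero (Or.inl hneg)]
    exact Nat.zero_le _
  push Not at hneg
  by_cases hl : level x = k
  · obtain ⟨m, rfl⟩ : ∃ m : Fin d → ℕ, x = fun i => (m i : ℤ) :=
      ⟨fun i => (x i).toNat, funext fun i => (Int.toNat_of_nonneg (hneg i)).symm⟩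
    have hm : ∑ i, m i = k := by
      have : ((∑ i, m i : ℕ) : ℤ) = k := by rw [← hl, level]; push_cast; rfl
      exact_mod_cast this
    calc endCount d k (fun i => (m i : ℤ)) ≤ endCount d k (fun i => (m i : ℤ)) * ∏ i, (m i)! :=
          Nat.le_mul_of_pos_right _ (Finset.prod_pos fun i _ => Nat.factorial_pos _)
      _ = k ! := endCount_natCast_mul_prod_factorial k m hm
  · rw [endCount_eq_zero (Or.inr hl)]
    exact Nat.zero_le _

/-- `j! · j^a ≤ a! · j^j` for all `a, j` (log-convexity of the factorial at an integer point).
[folklore] -/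
theorem factorial_mul_pow_le (a j : ℕ) : j ! * j ^ a ≤ a ! * j ^ j := by
  rcases le_or_gt j a with h | h
  · obtain ⟨t, rfl⟩ := Nat.exists_eq_add_of_le h
    clear h
    have key : j ! * j ^ t ≤ (j + t)! := by
      induction t with
      | zero => simp
      | succ t ih =>
        calc j ! * j ^ (t + 1) = j ! * j ^ t * j := by ring
          _ ≤ (j + t)! * (j + t + 1) := Nat.mul_le_mul ih (by omega)
          _ = (j + (t + 1))! := by rw [← add_assoc, Nat.factorial_succ, mul_comm]
    calc j ! * j ^ (j + t) = j ! * j ^ t * j ^ j := by ring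
      _ ≤ (j + t)! * j ^ j := Nat.mul_le_mul_right _ key
  · obtain ⟨s, rfl⟩ := Nat.exists_eq_add_of_lt h
    -- `j = a + s + 1`; `(a + t)! ≤ a! (a + t)^t`
    have key : ∀ t, (a + t)! ≤ a ! * (a + t) ^ t := by
      intro t
      induction t with
      | zero => simp
      | succ t ih =>
        calc (a + (t + 1))! = (a + t + 1) * (a + t)! := by rw [← add_assoc, Nat.factorial_succ]
          _ ≤ (a + t + 1) * (a ! * (a + t) ^ t) := Nat.mul_le_mul_left _ ih
          _ ≤ (a + t + 1) * (a ! * (a + t + 1) ^ t) :=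
              Nat.mul_le_mul_left _ (Nat.mul_le_mul_left _ (Nat.pow_le_pow_left (by omega) _))
          _ = a ! * (a + (t + 1)) ^ (t + 1) := by rw [← add_assoc]; ring
    calc (a + s + 1)! * (a + s + 1) ^ a ≤ a ! * (a + s + 1) ^ (s + 1) * (a + s + 1) ^ a :=
          Nat.mul_le_mul_right _ (by simpa [add_assoc] using key (s + 1))
      _ = a ! * (a + s + 1) ^ (a + s + 1) := by ring

/-- `(j!)^d ≤ ∏ᵢ mᵢ!` whenever `Σᵢ mᵢ = jd`: the multinomial coefficient is largest at the
balanced vector (BDNS (4.9), following Cox–Durrett). [cite: BockEtAl2020, §4 (4.9)] -/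
theorem pow_factorial_le_prod_factorial (m : Fin d → ℕ) {j : ℕ} (hm : ∑ i, m i = j * d) :
    j ! ^ d ≤ ∏ i, (m i)! := by
  rcases Nat.eq_zero_or_pos j with rfl | hj
  · rw [Nat.factorial_zero, one_pow]
    exact Finset.one_le_prod' fun i _ => Nat.succ_le_of_lt (Nat.factorial_pos _)
  · have h := Finset.prod_le_prod (s := univ) (fun i _ => Nat.zero_le _)
      (fun i _ => factorial_mul_pow_le (m i) j)
    rw [Finset.prod_mul_distrib, Finset.prod_mul_distrib, Finset.prod_const,
      Finset.prod_pow_eq_pow_sum, Finset.prod_const, Finset.card_univ, Fintype.card_fin, hm,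
      ← pow_mul] at h
    exact Nat.le_of_mul_le_mul_right h (pow_pos hj _)

/-- `#{S_{jd} = x} · (j!)^d ≤ (jd)!` (BDNS (4.9): `max_y P(S_{jd} = y) ≤ d^{-jd}(jd)!/(j!)^d`).
[cite: BockEtAl2020, §4 (4.9)] -/
theorem endCount_balanced_mul_le (j : ℕ) (x : Site d) :
    endCount d (j * d) x * j ! ^ d ≤ (j * d)! := by
  by_cases hneg : ∃ i, x i < 0
  · rw [endCount_eq_zero (Or.inl hneg), zero_mul]
    exact Nat.zero_le _
  push Not at hneg
  by_cases hl : level x = (j * d : ℕ)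
  · obtain ⟨m, rfl⟩ : ∃ m : Fin d → ℕ, x = fun i => (m i : ℤ) :=
      ⟨fun i => (x i).toNat, funext fun i => (Int.toNat_of_nonneg (hneg i)).symm⟩
    have hm : ∑ i, m i = j * d := by
      have : ((∑ i, m i : ℕ) : ℤ) = (j * d : ℕ) := by rw [← hl, level]; push_cast; rfl
      exact_mod_cast this
    calc endCount d (j * d) (fun i => (m i : ℤ)) * j ! ^ d
        ≤ endCount d (j * d) (fun i => (m i : ℤ)) * ∏ i, (m i)! :=
          Nat.mul_le_mul_left _ (pow_factorial_le_prod_factorial m hm)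
      _ = (j * d)! := endCount_natCast_mul_prod_factorial _ m hm
  · rw [endCount_eq_zero (Or.inr hl), zero_mul]
    exact Nat.zero_le _

/-! ### `P(S'_k - S_k = z)` as a normalized pair count -/

/-- `P(S'_k - S_k = z)` for two independent uniform oriented `k`-step walks: the number of pairs
`(w, w')` with `opos w' k - opos w k = z`, divided by `d^{2k}`. [cite: BockEtAl2020, §3–§4] -/
def diffProb (d k : ℕ) (z : Site d) : ℝ :=
  ((d : ℝ) ^ (2 * k))⁻¹ *
    ∑ w : Fin k → Fin d, ∑ w' : Fin k → Fin d, if opos w' k - opos w k = z then 1 else 0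

/-- `P ≥ 0`. [folklore] -/
theorem diffProb_nonneg (d k : ℕ) (z : Site d) : 0 ≤ diffProb d k z :=
  mul_nonneg (by positivity) (Finset.sum_nonneg fun _ _ => Finset.sum_nonneg fun _ _ => by
    positivity)

/-- At time `0` the difference is `0`. [folklore] -/
theorem diffProb_zero (d : ℕ) (z : Site d) : diffProb d 0 z = if z = 0 then 1 else 0 := by
  simp only [diffProb, mul_zero, pow_zero, inv_one, one_mul, opos_zero, sub_zero]
  rw [Fintype.sum_unique, Fintype.sum_unique]
  by_cases hz : z = 0 <;> simp [hz, eq_comm]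

/-- **First-step recursion of the difference chain**: `S'_{k+1} - S_{k+1} = (S'_k - S_k) + e_{a'} - e_a`
with `(a, a')` uniform on `[d]²`, i.e. `P_{k+1}(z) = d^{-2} Σ_{a,a'} P_k(z + e_a - e_{a'})`.
[cite: BockEtAl2020, §3 (the chain (S_n - S'_n))] -/
theorem diffProb_succ (d k : ℕ) (z : Site d) :
    diffProb d (k + 1) z = ((d : ℝ) ^ 2)⁻¹ * ∑ a : Fin d, ∑ a' : Fin d,
      diffProb d k (z + Pi.single a 1 - Pi.single a' 1) := by
  simp only [diffProb]
  rw [sum_wordPair_succ]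
  rw [Finset.mul_sum, Finset.mul_sum]
  refine Finset.sum_congr rfl fun a _ => ?_
  rw [Finset.mul_sum, Finset.mul_sum]
  refine Finset.sum_congr rfl fun a' _ => ?_
  rw [← mul_assoc]
  congr 1
  · rw [← mul_inv, ← pow_add]
    congr 2
    ring
  · refine Finset.sum_congr rfl fun v _ => Finset.sum_congr rfl fun v' _ => ?_
    rw [opos_cons_succ, opos_cons_succ]
    have : (Pi.single a' 1 + opos v' k - (Pi.single a 1 + opos v k) = z) ↔
        (opos v' k - opos v k = z + Pi.single a 1 - Pi.single a' 1) := by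
      constructor <;> intro h <;> linear_combination h
    simp only [this]

/-- `d^{2k} P(S'_k - S_k = z) = Σ_w #{w' : S'_k = z + S_k(w)}`. [folklore] -/
theorem diffProb_eq_sum_endCount (d k : ℕ) (z : Site d) :
    diffProb d k z = ((d : ℝ) ^ (2 * k))⁻¹ *
      ∑ w : Fin k → Fin d, (endCount d k (z + opos w k) : ℝ) := by
  rw [diffProb]
  congr 1
  refine Finset.sum_congr rfl fun w _ => ?_
  rw [endCount, Finset.natCast_card_filter]
  refine Finset.sum_congr rfl fun w' _ => ?_
  simp only [sub_eq_iff_eq_add]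

/-- **`P(S'_k - S_k = z) ≤ max_x P(S_k = x)`** (condition on `S_k`): if `#{S_k = x} ≤ C` for all `x`
then `diffProb d k z ≤ C / d^k`. [cite: BockEtAl2020, §4 (`P(τ = k) ≤ max_x P(S_k = x)`)] -/
theorem diffProb_le_of_endCount_le {k C : ℕ} (hC : ∀ x, endCount d k x ≤ C) (z : Site d) :
    diffProb d k z ≤ C / (d : ℝ) ^ k := by
  rw [diffProb_eq_sum_endCount]
  rcases Nat.eq_zero_or_pos d with rfl | hd
  · cases k with
    | zero =>
      simp only [mul_zero, pow_zero, inv_one, one_mul, div_one]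
      rw [Fintype.sum_unique]
      exact_mod_cast hC _
    | succ k =>
      have : IsEmpty (Fin (k + 1) → Fin 0) := by
        refine ⟨fun w => ?_⟩
        exact (w 0).elim0
      simp
  · have hdpos : (0 : ℝ) < (d : ℝ) ^ k := by positivity
    calc ((d : ℝ) ^ (2 * k))⁻¹ * ∑ w : Fin k → Fin d, (endCount d k (z + opos w k) : ℝ)
        ≤ ((d : ℝ) ^ (2 * k))⁻¹ * ∑ _w : Fin k → Fin d, (C : ℝ) := by
          refine mul_le_mul_of_nonneg_left (Finset.sum_le_sum fun w _ => ?_) (by positivity)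
          exact_mod_cast hC _
      _ = C / (d : ℝ) ^ k := by
          rw [Finset.sum_const, Finset.card_univ, Fintype.card_fun, Fintype.card_fin, Fintype.card_fin,
            nsmul_eq_mul]
          push_cast
          field_simp
          ring

/-- `P(S'_k - S_k = z) ≤ k!/d^k`. [cite: BockEtAl2020, §4 (4.8)] -/
theorem diffProb_le_factorial_div (d k : ℕ) (z : Site d) :
    diffProb d k z ≤ k ! / (d : ℝ) ^ k :=
  diffProb_le_of_endCount_le (endCount_le_factorial k) z

/-- `P(S'_k - S_k = z) ≤ (jd)! / ((j!)^d d^{jd})` for every `k ≥ jd`. [cite: BockEtAl2020, §4 (4.9)] -/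
theorem diffProb_le_balanced (hd : 1 ≤ d) (j i : ℕ) (z : Site d) :
    diffProb d (j * d + i) z ≤ (j * d)! / ((j ! : ℝ) ^ d * (d : ℝ) ^ (j * d)) := by
  have hC : ∀ x, endCount d (j * d) x ≤ (j * d)! / j ! ^ d := fun x =>
    (Nat.le_div_iff_mul_le (pow_pos (Nat.factorial_pos j) d)).2 (endCount_balanced_mul_le j x)
  have h1 := diffProb_le_of_endCount_le (endCount_add_le hC i) z
  refine h1.trans ?_
  have hdr : (0 : ℝ) < d := by exact_mod_cast hd
  have hfj : (0 : ℝ) < (j ! : ℝ) ^ d := by positivity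
  rw [div_le_div_iff₀ (by positivity) (by positivity)]
  have hdiv : (((j * d)! / j ! ^ d : ℕ) : ℝ) ≤ (j * d)! / (j ! : ℝ) ^ d := by
    rw [le_div_iff₀ hfj]
    exact_mod_cast Nat.div_mul_le_self _ _
  calc ((d ^ i * ((j * d)! / j ! ^ d) : ℕ) : ℝ) * ((j ! : ℝ) ^ d * (d : ℝ) ^ (j * d))
      = (((j * d)! / j ! ^ d : ℕ) : ℝ) * ((j ! : ℝ) ^ d * ((d : ℝ) ^ i * (d : ℝ) ^ (j * d))) := by
        push_cast; ring
    _ ≤ ((j * d)! / (j ! : ℝ) ^ d) * ((j ! : ℝ) ^ d * ((d : ℝ) ^ i * (d : ℝ) ^ (j * d))) :=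
        mul_le_mul_of_nonneg_right hdiv (by positivity)
    _ = ((j * d)! : ℝ) * (d : ℝ) ^ (j * d + i) := by
        field_simp
        ring

end Literature.Probability.Percolation

end
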